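import Summits.Parity.GeneralizedHardyLittlewood.Theorems.PrimeLevelFamEdgeMomentsBeyondDiagonalDiagProfileOne
import HarnessLib

/-!
# Route `PrimeLevelFamEdge`, crux K_A `MomentsBeyondDiagonal` (stmt-Parity-20007), line «petersson_layers» v4, stub `stub_diag`:
# **the `Q := 1` restriction of `SubDiag` in the deck's own vocabulary**

`stub_diag : SubDiag = SubOf (fun q _ P Q Δ' ↦ diagPart q P Q Δ')` (deck 21a, `HasShape`/`SubOf`) asks for the second-display
shape for every admissible `P` AND every even-or-odd `Q`. This file records, in exactly that vocabulary, what the `Q = 1` chain of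
gens g3–g6 proves: the level family `(q, P, Q, Δ') ↦ diagPart q P 1 Δ'` (the diagonal part with the `Q`-slot frozen at `1`)
HAS the shape on the window `(1, 3/2]` with the level-free functional `t(Δ', P, ·) = KMV2000.secondMomentForm Δ' P 1`
(`…DiagProfileOne.diagPart_profile_one_asymp`; the primality and `M ∉ ℕ` side conditions of `HasShape` are not needed).

* `hasShape_diagPart_at_one`, `subOf_diagPart_at_one`.

Helper `--supports stmt-Parity-20007`: NOT the registered stub (whose family keeps the `Q`-slot live) — the general even-or-odd
`Q` needs the census items R2/R3(ii); closes nothing; K_A, K_B and the Parity summit are NOT proved; nothing about Landau–Siegel zeros.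
-/

noncomputable section

open Literature.NumberTheory.LFunctions

namespace Summit.Parity.GeneralizedHardyLittlewood.Theorems.MomentsBeyondDiagonal.DiagLines

open Summit.Parity.GeneralizedHardyLittlewood.Theorems.PrimeLevelFamEdgeIdeaDeltas.PeterssonLayers
  (diagPart HasShape SubOf)

/-- **`SubDiag` with the `Q`-slot frozen at `1`, as a `HasShape` statement:** the family `diagPart q P 1 Δ'` has the
second-display shape on `(1, 3/2]` with `t = secondMomentForm Δ' P 1`, for every admissible `P` (the `Q` argument and the
primality / `M ∉ ℕ` side conditions are idle). [cite: KowalskiMichelVanderKam2000, Prop. 5.1 (31) p. 18 — derivation (Q = 1, general admissible P)] -/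
theorem hasShape_diagPart_at_one :
    HasShape (fun q _ P _ Δ' ↦ diagPart q P 1 Δ') (3 / 2) (fun Δ' P _ ↦ KMV2000.secondMomentForm Δ' P 1) := by
  intro P Q hP _ Δ' h1 h32
  obtain ⟨C, q₀, h⟩ := diagPart_profile_one_asymp hP h1 h32
  refine ⟨C, q₀, ?_⟩
  intro q _ _ hq _
  exact h q hq

/-- **`SubOf` for the `Q := 1` diagonal family** (window `(1, 3/2]`, functional `secondMomentForm Δ' P 1`).
[cite: KowalskiMichelVanderKam2000, Prop. 5.1 (31) p. 18 — derivation (Q = 1, general admissible P)] -/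
theorem subOf_diagPart_at_one : SubOf (fun q _ P _ Δ' ↦ diagPart q P 1 Δ') :=
  ⟨3 / 2, by norm_num, _, hasShape_diagPart_at_one⟩

end Summit.Parity.GeneralizedHardyLittlewood.Theorems.MomentsBeyondDiagonal.DiagLines

end
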